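import Summits.RiemannHypothesis.RiemannHypothesis.Theorems.EarlyAppointmentsRemainder0XiHeightSumAbel
import Literature.NumberTheory.LFunctions.ZetaZeroSumsLehmanExplicit
import Literature.NumberTheory.LFunctions.ZetaArgHSW

/-!
# ⟨24730⟩ ρ2 v4 — the ABEL COMPARISON BOUND for Ξ-height sums (engine of `stub_farAbel4` leaves 1–2)

C4 «kernel desk» rh-idea-6 g30, director (CA406)(c)/(d).  SUPPORT module for crux r3 `Remainder0Xi` of route
`EarlyAppointments` (line rho2_v4), fully proved, standard axioms; imports = the pre-image `…HeightSumAbel`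
(C4 g30, 289ab1de) + Literature `ZetaZeroSumsLehmanExplicit` (`lehman_identity`, `hasDerivAt_countMain`) + `ZetaArgHSW`
(`zetaZeroCount_hasanalizade_shen_wong_holds`).

★ `abel_bound`: for `0 < a ≤ b`, `φ ∈ C¹[a,b]` MONOTONE (`φ'` of one sign) and `|N(t) − countMain t| ≤ W` on `[a,b]`,
`|Σᶠ_{Ξρ=0, a<Re ρ≤b} ord_ρ·φ(Re ρ) − (1/2π)∫_a^b φ(t) log(t/2π) dt| ≤ W·(|φ a| + |φ b| + |φ b − φ a|)`
(= Ξ-side `finsum_heights_eq_sum_zerosBetween` + the tree's ζ-side `lehman_identity` + `|∫Qφ'| ≤ W∫|φ'| = W|φ b − φ a|`).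
★ `abs_Q_le_hsw` / `abs_Q_le_hsw_of_mem`: HSW Cor 1.2 in `countMain` form, `|N(t) − countMain t| ≤ 0.1038 log t + 0.2573 log log t
+ 10.2425` (`t ≥ e`), monotone envelope on `[a,b]`; ★ `abel_bound_hsw` = the two combined.  With `φ_up(t) = 2x/(t² − x²)` on
`[x + 67.5, T]` and `φ_dn(t) = 2x/(x² − t²)` on `[14, x − 67.5]` these are exactly the two edge estimates of LEAF 2 (`AbelMainLeaf`),
and with `1/(t − x)²`, `1/(t + x)²` the far inverse-square sums of LEAF 1 (`KernelShiftLeaf`) — see the HANDOFF recipe.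
Nothing here bears on the truth of RH; RH is not proved; 24730 OPEN.
-/

set_option linter.dupNamespace false
namespace Summit.RiemannHypothesis.RiemannHypothesis.Theorems.EarlyAppointmentsRemainder0Xi.HeightSumAbelBound

open Set MeasureTheory intervalIntegral Real
open Literature.NumberTheory.LFunctions
open Literature.NumberTheory.LFunctions.SchoenfeldBound (zerosBetween countMain intervalIntegrable_count_sub_mul)
open Summit.RiemannHypothesis.RiemannHypothesis.Theorems.EarlyAppointmentsRemainder0Xi.HeightSumAbel
  (heightBox finsum_heights_eq_sum_zerosBetween)

/-- `(N − countMain)·g` is interval-integrable on `[a, b]` for continuous `g` (`N` monotone, `countMain` continuous). -/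
theorem intervalIntegrable_Q_mul {a b : ℝ} (ha : 0 < a) (hab : a ≤ b) {g : ℝ → ℝ} (hg : ContinuousOn g (Icc a b)) :
    IntervalIntegrable (fun t ↦ ((zetaZeroCount t : ℝ) - countMain t) * g t) volume a b := by
  have hI : uIcc a b = Icc a b := uIcc_of_le hab
  have h1 : IntervalIntegrable (fun t ↦ ((zetaZeroCount t : ℝ) - zetaZeroCount a) * g t) volume a b :=
    intervalIntegrable_count_sub_mul (by rw [hI]; exact hg)
  have h2 : IntervalIntegrable (fun t ↦ ((zetaZeroCount a : ℝ) - countMain t) * g t) volume a b := by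
    apply ContinuousOn.intervalIntegrable
    rw [hI]
    exact (continuousOn_const.sub (continuousOn_countMain (b := b) ha)).mul hg
  have e : (fun t ↦ ((zetaZeroCount t : ℝ) - countMain t) * g t) =
      fun t ↦ ((zetaZeroCount t : ℝ) - zetaZeroCount a) * g t + ((zetaZeroCount a : ℝ) - countMain t) * g t := by
    funext t; ring
  rw [e]
  exact h1.add h2

/-- The integral term of Lehman's identity against a MONOTONE weight: `|∫_a^b Q φ'| ≤ W·|φ b − φ a|`. -/
theorem abs_integral_Q_mul_deriv_le {a b W : ℝ} (hab : a ≤ b) {φ φ' : ℝ → ℝ}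
    (hφ : ∀ t ∈ Icc a b, HasDerivAt φ (φ' t) t) (hφ' : ContinuousOn φ' (Icc a b))
    (hsign : (∀ t ∈ Icc a b, 0 ≤ φ' t) ∨ (∀ t ∈ Icc a b, φ' t ≤ 0))
    (hW : ∀ t ∈ Icc a b, |(zetaZeroCount t : ℝ) - countMain t| ≤ W) :
    |∫ t in a..b, ((zetaZeroCount t : ℝ) - countMain t) * φ' t| ≤ W * |φ b - φ a| := by
  have hI : uIcc a b = Icc a b := uIcc_of_le hab
  have hW0 : 0 ≤ W := (abs_nonneg _).trans (hW a (left_mem_Icc.2 hab))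
  have hφ'i : IntervalIntegrable φ' volume a b := hφ'.intervalIntegrable_of_Icc hab
  have hFTC : ∫ t in a..b, φ' t = φ b - φ a :=
    integral_eq_sub_of_hasDerivAt (by rw [hI]; exact hφ) hφ'i
  have hle : |∫ t in a..b, ((zetaZeroCount t : ℝ) - countMain t) * φ' t| ≤ ∫ t in a..b, W * |φ' t| := by
    have h := norm_integral_le_of_norm_le hab (f := fun t ↦ ((zetaZeroCount t : ℝ) - countMain t) * φ' t)
      (g := fun t ↦ W * |φ' t|) ?_ ((hφ'i.abs).const_mul W)
    · simpa only [Real.norm_eq_abs] using h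
    · exact Filter.Eventually.of_forall fun t ht ↦ by
        have htI : t ∈ Icc a b := Ioc_subset_Icc_self ht
        rw [Real.norm_eq_abs, abs_mul]
        exact mul_le_mul_of_nonneg_right (hW t htI) (abs_nonneg _)
  have habs : ∫ t in a..b, W * |φ' t| ≤ W * |φ b - φ a| := by
    rw [intervalIntegral.integral_const_mul]
    refine mul_le_mul_of_nonneg_left ?_ hW0
    rcases hsign with hpos | hneg
    · have e : ∫ t in a..b, |φ' t| = ∫ t in a..b, φ' t :=
        integral_congr fun t ht ↦ abs_of_nonneg (hpos t (by rwa [hI] at ht))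
      rw [e, hFTC]
      exact le_abs_self _
    · have e : ∫ t in a..b, |φ' t| = ∫ t in a..b, -φ' t :=
        integral_congr fun t ht ↦ abs_of_nonpos (hneg t (by rwa [hI] at ht))
      rw [e, intervalIntegral.integral_neg, hFTC]
      exact neg_le_abs _
  exact hle.trans habs

/-- ★ (K) **ABEL COMPARISON BOUND for Ξ-height sums.**  For `0 < a ≤ b`, `φ ∈ C¹[a,b]` with `φ'` of constant sign, and
`|N(t) − countMain t| ≤ W` on `[a,b]`:
`|Σᶠ_{Ξρ=0, a<Re ρ≤b} ord_ρ φ(Re ρ) − (∫_a^b φ·log(t/2π))/(2π)| ≤ W·(|φ a| + |φ b| + |φ b − φ a|)`. -/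
theorem abel_bound {a b W : ℝ} (ha : 0 < a) (hab : a ≤ b) {φ φ' : ℝ → ℝ}
    (hφ : ∀ t ∈ Icc a b, HasDerivAt φ (φ' t) t) (hφ' : ContinuousOn φ' (Icc a b))
    (hsign : (∀ t ∈ Icc a b, 0 ≤ φ' t) ∨ (∀ t ∈ Icc a b, φ' t ≤ 0))
    (hW : ∀ t ∈ Icc a b, |(zetaZeroCount t : ℝ) - countMain t| ≤ W) :
    |∑ᶠ ρ ∈ heightBox a b, ((analyticOrderAt riemannXiUpper ρ).toNat : ℝ) * φ ρ.re
        - (∫ t in a..b, φ t * Real.log (t / (2 * π))) / (2 * π)|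
      ≤ W * (|φ a| + |φ b| + |φ b - φ a|) := by
  have haI : a ∈ Icc a b := left_mem_Icc.2 hab
  have hbI : b ∈ Icc a b := right_mem_Icc.2 hab
  rw [finsum_heights_eq_sum_zerosBetween ha.le φ, lehman_identity ha hab hφ hφ']
  have hint := abs_integral_Q_mul_deriv_le hab hφ hφ' hsign hW
  have hb := hW b hbI
  have ha' := hW a haI
  have e : (∫ t in a..b, φ t * Real.log (t / (2 * π))) / (2 * π)
        + ((zetaZeroCount b : ℝ) - countMain b) * φ b
        - ((zetaZeroCount a : ℝ) - countMain a) * φ a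
        - (∫ t in a..b, ((zetaZeroCount t : ℝ) - countMain t) * φ' t)
        - (∫ t in a..b, φ t * Real.log (t / (2 * π))) / (2 * π)
      = ((zetaZeroCount b : ℝ) - countMain b) * φ b
        - ((zetaZeroCount a : ℝ) - countMain a) * φ a
        - ∫ t in a..b, ((zetaZeroCount t : ℝ) - countMain t) * φ' t := by ring
  rw [e]
  have h1 : |((zetaZeroCount b : ℝ) - countMain b) * φ b| ≤ W * |φ b| := by
    rw [abs_mul]; exact mul_le_mul_of_nonneg_right hb (abs_nonneg _)
  have h2 : |((zetaZeroCount a : ℝ) - countMain a) * φ a| ≤ W * |φ a| := by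
    rw [abs_mul]; exact mul_le_mul_of_nonneg_right ha' (abs_nonneg _)
  have h3 := abs_sub (((zetaZeroCount b : ℝ) - countMain b) * φ b - ((zetaZeroCount a : ℝ) - countMain a) * φ a)
    (∫ t in a..b, ((zetaZeroCount t : ℝ) - countMain t) * φ' t)
  have h4 := abs_sub (((zetaZeroCount b : ℝ) - countMain b) * φ b) (((zetaZeroCount a : ℝ) - countMain a) * φ a)
  nlinarith [h1, h2, h3, h4, hint, abs_nonneg (φ a), abs_nonneg (φ b)]

/-- (K) **HSW Corollary 1.2 in `countMain` form**: `|N(t) − countMain t| ≤ 0.1038 log t + 0.2573 log log t + 10.2425`, `t ≥ e`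
(the tree's `countMain` carries the `+7/8`, hence `10.2425 = 9.3675 + 0.875`). -/
theorem abs_Q_le_hsw {t : ℝ} (ht : Real.exp 1 ≤ t) :
    |(zetaZeroCount t : ℝ) - countMain t| ≤ 0.1038 * Real.log t + 0.2573 * Real.log (Real.log t) + 10.2425 := by
  have h := zetaZeroCount_hasanalizade_shen_wong_holds t ht
  have ht0 : 0 < t := lt_of_lt_of_le (Real.exp_pos 1) ht
  have hlog : Real.log (t / (2 * π * Real.exp 1)) = Real.log (t / (2 * π)) - 1 := by
    rw [show t / (2 * π * Real.exp 1) = t / (2 * π) / Real.exp 1 by ring,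
      Real.log_div (by positivity) (Real.exp_pos 1).ne', Real.log_exp]
  have e : (zetaZeroCount t : ℝ) - countMain t
      = ((zetaZeroCount t : ℝ) - t / (2 * π) * Real.log (t / (2 * π * Real.exp 1))) - 7 / 8 := by
    rw [hlog, countMain]; ring
  rw [e]
  have h2 := abs_sub ((zetaZeroCount t : ℝ) - t / (2 * π) * Real.log (t / (2 * π * Real.exp 1))) (7 / 8)
  have h78 : |(7 : ℝ) / 8| = 7 / 8 := abs_of_pos (by norm_num)
  linarith

/-- (K) the HSW envelope is monotone: on `[a, b]` with `a ≥ e` the bound at `b` serves for every `t`. -/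
theorem abs_Q_le_hsw_of_mem {a b t : ℝ} (ha : Real.exp 1 ≤ a) (ht : t ∈ Icc a b) :
    |(zetaZeroCount t : ℝ) - countMain t| ≤ 0.1038 * Real.log b + 0.2573 * Real.log (Real.log b) + 10.2425 := by
  have hta : Real.exp 1 ≤ t := ha.trans ht.1
  have ht0 : 0 < t := lt_of_lt_of_le (Real.exp_pos 1) hta
  have h := abs_Q_le_hsw hta
  have hl : Real.log t ≤ Real.log b := Real.log_le_log ht0 ht.2
  have hlt1 : 1 ≤ Real.log t := by rw [Real.le_log_iff_exp_le ht0]; exact hta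
  have hll : Real.log (Real.log t) ≤ Real.log (Real.log b) := Real.log_le_log (by linarith) hl
  nlinarith [hl, hll]

/-- ★ (K) **ABEL BOUND with the HSW envelope**: for `e ≤ a ≤ b` and a monotone `C¹` weight,
`|Σᶠ_{a<Re ρ≤b} ord_ρ φ(Re ρ) − (∫_a^b φ log(t/2π))/(2π)| ≤ W_N(b)·(|φ a| + |φ b| + |φ b − φ a|)`,
`W_N(b) = 0.1038 log b + 0.2573 log log b + 10.2425`. -/
theorem abel_bound_hsw {a b : ℝ} (ha : Real.exp 1 ≤ a) (hab : a ≤ b) {φ φ' : ℝ → ℝ}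
    (hφ : ∀ t ∈ Icc a b, HasDerivAt φ (φ' t) t) (hφ' : ContinuousOn φ' (Icc a b))
    (hsign : (∀ t ∈ Icc a b, 0 ≤ φ' t) ∨ (∀ t ∈ Icc a b, φ' t ≤ 0)) :
    |∑ᶠ ρ ∈ heightBox a b, ((analyticOrderAt riemannXiUpper ρ).toNat : ℝ) * φ ρ.re
        - (∫ t in a..b, φ t * Real.log (t / (2 * π))) / (2 * π)|
      ≤ (0.1038 * Real.log b + 0.2573 * Real.log (Real.log b) + 10.2425) * (|φ a| + |φ b| + |φ b - φ a|) :=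
  abel_bound (lt_of_lt_of_le (Real.exp_pos 1) ha) hab hφ hφ' hsign fun _ ht ↦ abs_Q_le_hsw_of_mem ha ht

end Summit.RiemannHypothesis.RiemannHypothesis.Theorems.EarlyAppointmentsRemainder0Xi.HeightSumAbelBound
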